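import Literature.Computability.Complexity.PrivateCoinGamesIP
import Literature.Computability.Complexity.PrivateCoinGamesIso
import HarnessLib

/-!
# Private-coin games: the completeness half of the bridge, and `Proves` / `IP[k]` from game data

Trunk T-CPLX-CORE, a complement to `PrivateCoinGamesIP.lean` (the verifier's game `IPVerifier.toGame`,
`toStrategy`, `acceptProb_eq_card_toGame`, soundness `acceptProb_le_third_of_opt`) and
`PrivateCoinGamesIso.lean` (`PCGame.Agrees`, `opt_congr_equiv`). Arora–Barak's completeness clause
(8.2) asks for SOME prover; in the game picture a prover is a strategy on message VECTORS, so one needs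
the converse of `toStrategy`:

* `IPVerifier.ofStrategy` — every strategy `σ` of the verifier's game on `x` (histories of vectors ↦ a
  vector) IS the normalised strategy of an honest-to-goodness `IPProver` (`toStrategy_ofStrategy`), whence
  `acceptProb_ofStrategy` (its acceptance probability is the game count of `σ`),
  `two_thirds_le_acceptProb_ofStrategy` / `exists_prover_of_card` (completeness from ONE count
  `2·2^c ≤ 3·#{r | the game accepts σ's transcript}`);
* `IPVerifier.proves_of_toGame`, `mem_IPRounds_of_toGame` — **`V.Proves k L` and `L ∈ IP[k]` from two
  numbers per input**: the completeness count of some strategy on `x ∈ L` and the soundness bound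
  `3·opt ≤ 2^c` on `x ∉ L`;
* transport along a coin bijection (`PCGame.Agrees`, typically between the machine's game, whose coins
  are bit vectors, and a protocol's game, whose coins are a product of uniform coordinates):
  `Agrees.play_eq`, `Agrees.transcript_eq`, `Agrees.accept_transcript_iff`,
  `Agrees.card_accept_transcript_eq` (a strategy is accepted on equally many coins in both games), and the
  resulting `acceptProb_le_third_of_agrees`, `two_thirds_le_acceptProb_of_agrees`,
  `exists_prover_of_agrees`, `proves_of_agrees`, `mem_IPRounds_of_agrees` — soundness and completeness
  of an `IPVerifier` read off ANY finite game agreeing with its own.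

Nothing here is specific to a protocol (written for the last step of the App. D campaign of
`Literature.Barriers.PneNP.AkaviaEtAl2006_complMemAM`, usable verbatim for Goldwasser–Sipser-type
simulations). All proved, [folklore] over [cite: AroraBarakCC2009, Def. 8.6].

## References

* [AroraBarakCC2009] S. Arora, B. Barak, *Computational Complexity: A Modern Approach*, CUP 2009,
  §8.1, Def. 8.6 with (8.2)–(8.3), Lemma 8.7 and the remarks after it (deterministic provers suffice).
-/

namespace Literature.Computability.Complexity

open Finset _root_.Computability

open scoped Classical

/-! ### Transport of plays and acceptance counts along a coin bijection -/

namespace PCGame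

variable {R R' M : Type*} {G : PCGame R M} {G' : PCGame R' M} {φ : R' ≃ R}

/-- **Agreeing games play identically** against every strategy, from every history. [folklore] -/
theorem Agrees.play_eq (hA : Agrees G G' φ) (r' : R') (σ : List M → M) :
    ∀ (n : ℕ) (h : List M), G'.play r' σ n h = G.play (φ r') σ n h
  | 0, _ => rfl
  | n + 1, h => by
    rw [play_succ, play_succ, hA.next_eq]
    exact Agrees.play_eq hA r' σ n _

/-- Agreeing games have the same transcripts. [folklore] -/
theorem Agrees.transcript_eq (hA : Agrees G G' φ) (k : ℕ) (r' : R') (σ : List M → M) :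
    G'.transcript k r' σ = G.transcript k (φ r') σ :=
  hA.play_eq r' σ k []

/-- Agreeing games accept a strategy on corresponding coins alike. [folklore] -/
theorem Agrees.accept_transcript_iff (hA : Agrees G G' φ) (k : ℕ) (r' : R') (σ : List M → M) :
    G'.accept r' (G'.transcript k r' σ) ↔ G.accept (φ r') (G.transcript k (φ r') σ) := by
  rw [hA.transcript_eq, hA.accept_iff]

variable [Fintype R] [Fintype R']

/-- **A strategy is accepted on equally many coins in two agreeing games.** [folklore] -/
theorem Agrees.card_accept_transcript_eq (hA : Agrees G G' φ) (k : ℕ) (σ : List M → M) :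
    (univ.filter fun r' => G'.accept r' (G'.transcript k r' σ)).card =
      (univ.filter fun r => G.accept r (G.transcript k r σ)).card := by
  refine card_bij (fun r' _ => φ r') (fun r' hr => ?_) (fun a _ b _ hab => φ.injective hab)
    (fun r hr => ⟨φ.symm r, ?_, φ.apply_symm_apply r⟩)
  · rw [mem_filter] at hr ⊢
    exact ⟨mem_univ _, (hA.accept_transcript_iff k r' σ).1 hr.2⟩
  · rw [mem_filter] at hr ⊢
    refine ⟨mem_univ _, (hA.accept_transcript_iff k _ σ).2 ?_⟩
    rw [φ.apply_symm_apply]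
    exact hr.2

end PCGame

/-! ### Every game strategy is a prover -/

namespace IPVerifier

/-- Re-reading a string as a message vector of length `m` (truncate / pad with `false`, exactly the
normalisation of the interaction). [cite: AroraBarakCC2009, Def. 8.6] -/
def reVec (m : ℕ) (l : List Bool) : List.Vector Bool m :=
  ⟨l.takeD m false, List.takeD_length _ _ _⟩

/-- A vector's string, normalised to its own length, is itself. [folklore] -/
theorem takeD_toList_vector {m : ℕ} (v : List.Vector Bool m) : v.toList.takeD m false = v.toList := by
  have h := List.takeD_left' (l₂ := ([] : List Bool)) (a := false) (List.Vector.toList_length v)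
  rwa [List.append_nil] at h

/-- Re-reading a vector's string gives the vector back. [folklore] -/
@[simp] theorem reVec_toList {m : ℕ} (v : List.Vector Bool m) : reVec m v.toList = v :=
  List.Vector.toList_injective (by rw [reVec, List.Vector.toList_mk, takeD_toList_vector])

/-- Re-reading a history of vectors, written as strings, gives the history back. [folklore] -/
theorem map_reVec_map_toList {m : ℕ} :
    ∀ h : List (List.Vector Bool m), (h.map List.Vector.toList).map (reVec m) = h
  | [] => rfl
  | v :: h => by rw [List.map_cons, List.map_cons, reVec_toList, map_reVec_map_toList h]

/-- **The prover of a game strategy**: it re-reads the history as vectors of length `m` and answers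
with the strategy's vector, as a string. (AB (8.2): "there exists `P`"; deterministic strategies on the
normalised messages are all one ever needs, Remark after Lemma 8.7.) [cite: AroraBarakCC2009, Def. 8.6] -/
def ofStrategy (m : ℕ) (σ : List (List.Vector Bool m) → List.Vector Bool m) : IPProver :=
  fun h => (σ (h.map (reVec m))).toList

/-- **Its normalised strategy is the given one** (`toStrategy ∘ ofStrategy = id`). [folklore] -/
@[simp] theorem toStrategy_ofStrategy (m : ℕ) (σ : List (List.Vector Bool m) → List.Vector Bool m) :
    toStrategy m (ofStrategy m σ) = σ := by
  funext h
  apply List.Vector.toList_injective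
  show ((σ ((h.map List.Vector.toList).map (reVec m))).toList).takeD m false = (σ h).toList
  rw [map_reVec_map_toList, takeD_toList_vector]

variable (V : IPVerifier) (x : List Bool)

/-- **The acceptance probability of the prover of `σ` is the game count of `σ`.**
[cite: AroraBarakCC2009, Def. 8.6] -/
theorem acceptProb_ofStrategy (k : ℕ)
    (σ : List (List.Vector Bool (V.msgLen.eval x.length)) → List.Vector Bool (V.msgLen.eval x.length)) :
    V.acceptProb k x (ofStrategy _ σ) =
      ((univ.filter fun r : List.Vector Bool (V.coins.eval x.length) =>
        (V.toGame x).accept r ((V.toGame x).transcript k r σ)).card : ℝ) / 2 ^ (V.coins.eval x.length) := by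
  rw [acceptProb_eq_card_toGame, toStrategy_ofStrategy]

/-- **Completeness from one count**: if `σ` is accepted on at least two thirds of the coins, its prover
is accepted with probability at least `2/3`. [cite: AroraBarakCC2009, Def. 8.6 (8.2)] -/
theorem two_thirds_le_acceptProb_ofStrategy (k : ℕ)
    (σ : List (List.Vector Bool (V.msgLen.eval x.length)) → List.Vector Bool (V.msgLen.eval x.length))
    (h : 2 * 2 ^ (V.coins.eval x.length) ≤
      3 * (univ.filter fun r : List.Vector Bool (V.coins.eval x.length) =>
        (V.toGame x).accept r ((V.toGame x).transcript k r σ)).card) :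
    (2 / 3 : ℝ) ≤ V.acceptProb k x (ofStrategy _ σ) := by
  rw [acceptProb_ofStrategy, le_div_iff₀ (by positivity)]
  have h' : (2 : ℝ) * 2 ^ (V.coins.eval x.length) ≤
      3 * ((univ.filter fun r : List.Vector Bool (V.coins.eval x.length) =>
        (V.toGame x).accept r ((V.toGame x).transcript k r σ)).card : ℝ) := by
    exact_mod_cast h
  linarith

/-- The completeness clause of `Proves` on one input, from a strategy of the verifier's game accepted
on at least two thirds of the coins. [cite: AroraBarakCC2009, Def. 8.6 (8.2)] -/
theorem exists_prover_of_card (k : ℕ)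
    (σ : List (List.Vector Bool (V.msgLen.eval x.length)) → List.Vector Bool (V.msgLen.eval x.length))
    (h : 2 * 2 ^ (V.coins.eval x.length) ≤
      3 * (univ.filter fun r : List.Vector Bool (V.coins.eval x.length) =>
        (V.toGame x).accept r ((V.toGame x).transcript k r σ)).card) :
    ∃ P : IPProver, (2 / 3 : ℝ) ≤ V.acceptProb k x P :=
  ⟨_, V.two_thirds_le_acceptProb_ofStrategy x k σ h⟩

/-! ### `Proves` and `IP[k]` from game data -/

variable {V}

/-- **`V` proves `L` from two numbers per input**: on `x ∈ L` some strategy of its game is accepted on at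
least two thirds of the coins; on `x ∉ L` the game value is at most a third of the coins.
[cite: AroraBarakCC2009, Def. 8.6 (8.2)–(8.3)] -/
theorem proves_of_toGame {k : ℕ → ℕ} {L : Language Bool}
    (hc : ∀ x, x ∈ L →
      ∃ σ : List (List.Vector Bool (V.msgLen.eval x.length)) → List.Vector Bool (V.msgLen.eval x.length),
        2 * 2 ^ (V.coins.eval x.length) ≤
          3 * (univ.filter fun r : List.Vector Bool (V.coins.eval x.length) =>
            (V.toGame x).accept r ((V.toGame x).transcript (k x.length) r σ)).card)
    (hs : ∀ x, x ∉ L → 3 * (V.toGame x).opt (k x.length) [] ≤ 2 ^ (V.coins.eval x.length)) :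
    V.Proves k L := fun x =>
  ⟨fun hx => by
    obtain ⟨σ, hσ⟩ := hc x hx
    exact V.exists_prover_of_card x _ σ hσ,
   fun hx P => V.acceptProb_le_third_of_opt x _ (hs x hx) P⟩

/-- **`L ∈ IP[k]` from a polynomial-time verifier and two numbers per input.**
[cite: AroraBarakCC2009, Def. 8.6] -/
theorem mem_IPRounds_of_toGame (hV : V.IsPolyTime) {k : ℕ → ℕ} {L : Language Bool}
    (hc : ∀ x, x ∈ L →
      ∃ σ : List (List.Vector Bool (V.msgLen.eval x.length)) → List.Vector Bool (V.msgLen.eval x.length),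
        2 * 2 ^ (V.coins.eval x.length) ≤
          3 * (univ.filter fun r : List.Vector Bool (V.coins.eval x.length) =>
            (V.toGame x).accept r ((V.toGame x).transcript (k x.length) r σ)).card)
    (hs : ∀ x, x ∉ L → 3 * (V.toGame x).opt (k x.length) [] ≤ 2 ^ (V.coins.eval x.length)) :
    L ∈ IPRounds k :=
  ⟨V, hV, proves_of_toGame hc hs⟩

/-! ### The same through a game agreeing with the verifier's along a coin bijection -/

/-- A coin space in bijection with the bit vectors of length `c` has `2^c` elements. [folklore] -/
theorem card_eq_two_pow_of_equiv {c : ℕ} {Rx : Type*} [Fintype Rx] (φ : List.Vector Bool c ≃ Rx) :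
    Fintype.card Rx = 2 ^ c := by
  rw [← Fintype.card_congr φ, card_vector, Fintype.card_bool]

variable (V)
variable {Rx : Type*} [Fintype Rx] {G : PCGame Rx (List.Vector Bool (V.msgLen.eval x.length))}
  {φ : List.Vector Bool (V.coins.eval x.length) ≃ Rx}

/-- **Soundness read off an agreeing game**: if `3·opt_G k [] ≤ |coins of G|`, every prover is accepted
by `V` on `x` with probability at most `1/3`. [cite: AroraBarakCC2009, Def. 8.6 (8.3)] -/
theorem acceptProb_le_third_of_agrees (hA : G.Agrees (V.toGame x) φ) (k : ℕ)
    (hs : 3 * G.opt k [] ≤ Fintype.card Rx) (P : IPProver) : V.acceptProb k x P ≤ 1 / 3 :=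
  V.acceptProb_le_third_of_opt x k
    (by rw [PCGame.opt_congr_equiv hA, ← card_eq_two_pow_of_equiv φ]; exact hs) P

/-- **Completeness read off an agreeing game**: a strategy of `G` accepted on at least two thirds of
`G`'s coins gives a prover accepted by `V` on `x` with probability at least `2/3`.
[cite: AroraBarakCC2009, Def. 8.6 (8.2)] -/
theorem two_thirds_le_acceptProb_of_agrees (hA : G.Agrees (V.toGame x) φ) (k : ℕ)
    (σ : List (List.Vector Bool (V.msgLen.eval x.length)) → List.Vector Bool (V.msgLen.eval x.length))
    (hc : 2 * Fintype.card Rx ≤ 3 * (univ.filter fun r : Rx => G.accept r (G.transcript k r σ)).card) :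
    (2 / 3 : ℝ) ≤ V.acceptProb k x (ofStrategy _ σ) := by
  apply two_thirds_le_acceptProb_ofStrategy
  rw [PCGame.Agrees.card_accept_transcript_eq hA, ← card_eq_two_pow_of_equiv φ]
  exact hc

/-- The completeness clause on one input, read off an agreeing game. [cite: AroraBarakCC2009, Def. 8.6 (8.2)] -/
theorem exists_prover_of_agrees (hA : G.Agrees (V.toGame x) φ) (k : ℕ)
    (σ : List (List.Vector Bool (V.msgLen.eval x.length)) → List.Vector Bool (V.msgLen.eval x.length))
    (hc : 2 * Fintype.card Rx ≤ 3 * (univ.filter fun r : Rx => G.accept r (G.transcript k r σ)).card) :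
    ∃ P : IPProver, (2 / 3 : ℝ) ≤ V.acceptProb k x P :=
  ⟨_, V.two_thirds_le_acceptProb_of_agrees x hA k σ hc⟩

variable {V}

/-- **`V` proves `L`, read off a family of finite games** `G x` agreeing input by input with the
verifier's own along coin bijections `φ x`: completeness = on `x ∈ L` some strategy of `G x` is accepted
on at least two thirds of its coins; soundness = on `x ∉ L`, `3·opt ≤ |coins|`.
[cite: AroraBarakCC2009, Def. 8.6 (8.2)–(8.3)] -/
theorem proves_of_agrees {k : ℕ → ℕ} {L : Language Bool} {Rf : List Bool → Type*} [∀ x, Fintype (Rf x)]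
    {Gf : ∀ x : List Bool, PCGame (Rf x) (List.Vector Bool (V.msgLen.eval x.length))}
    {φf : ∀ x : List Bool, List.Vector Bool (V.coins.eval x.length) ≃ Rf x}
    (hA : ∀ x, (Gf x).Agrees (V.toGame x) (φf x))
    (hc : ∀ x, x ∈ L →
      ∃ σ : List (List.Vector Bool (V.msgLen.eval x.length)) → List.Vector Bool (V.msgLen.eval x.length),
        2 * Fintype.card (Rf x) ≤ 3 * (univ.filter fun r : Rf x => (Gf x).accept r ((Gf x).transcript (k x.length) r σ)).card)
    (hs : ∀ x, x ∉ L → 3 * (Gf x).opt (k x.length) [] ≤ Fintype.card (Rf x)) :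
    V.Proves k L := fun x =>
  ⟨fun hx => by
    obtain ⟨σ, hσ⟩ := hc x hx
    exact V.exists_prover_of_agrees x (hA x) _ σ hσ,
   fun hx P => V.acceptProb_le_third_of_agrees x (hA x) _ (hs x hx) P⟩

/-- **`L ∈ IP[k]` from a polynomial-time verifier and a family of agreeing finite games.**
[cite: AroraBarakCC2009, Def. 8.6] -/
theorem mem_IPRounds_of_agrees (hV : V.IsPolyTime) {k : ℕ → ℕ} {L : Language Bool}
    {Rf : List Bool → Type*} [∀ x, Fintype (Rf x)]
    {Gf : ∀ x : List Bool, PCGame (Rf x) (List.Vector Bool (V.msgLen.eval x.length))}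
    {φf : ∀ x : List Bool, List.Vector Bool (V.coins.eval x.length) ≃ Rf x}
    (hA : ∀ x, (Gf x).Agrees (V.toGame x) (φf x))
    (hc : ∀ x, x ∈ L →
      ∃ σ : List (List.Vector Bool (V.msgLen.eval x.length)) → List.Vector Bool (V.msgLen.eval x.length),
        2 * Fintype.card (Rf x) ≤ 3 * (univ.filter fun r : Rf x => (Gf x).accept r ((Gf x).transcript (k x.length) r σ)).card)
    (hs : ∀ x, x ∉ L → 3 * (Gf x).opt (k x.length) [] ≤ Fintype.card (Rf x)) :
    L ∈ IPRounds k :=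
  ⟨V, hV, proves_of_agrees hA hc hs⟩

end IPVerifier

end Literature.Computability.Complexity
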